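import Literature.NumberTheory.DiophantineGeometry.MultiplicativeGroupApproximation
import HarnessLib

/-!
# Stub `stub_lflInput` of line `matveev-face-clearing` (crux stmt-ABC-1563): conditional discharge

Helper (`--supports stmt-ABC-1563`) for the registered stub

  `stub_lflInput : ∃ K : ℝ, 1 ≤ K ∧ Dioph.PastenApproximationBound K`

of the line `matveev-face-clearing` for the crux
`Summit.ABC.ABC.Theses.RibetTakahashiSplit.FewPrimeValuationProduct`. The stub is the line's ONLY
external input: Matveev + Yu over `ℚ` in Pasten's form (H. Pasten, Invent. Math. 236 (2024),
Theorem 2.1 with `d = 1`). It is not provable unconditionally in the tree (lower bounds for linear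
forms in complex and `p`-adic logarithms are far beyond Mathlib); in the tree it is ONE LINE from
the unproved named fact
`Literature.NumberTheory.DiophantineGeometry.Dioph.evertseGyory_thm_4_2_1_rat`
(Evertse–Győry 2015, Thm 4.2.1 over `ℚ`) via the PROVED reduction
`Dioph.pasten2024_thm_2_1 : evertseGyory_thm_4_2_1_rat → PastenApproximationBound pastenK` and
`Dioph.one_le_pastenK : 1 ≤ pastenK`.

This file records exactly that one line, so that the stub is `blocked-on` the named fact and
closes the moment a discharge of `evertseGyory_thm_4_2_1_rat` lands:

* `stub_lflInput_of_evertseGyory :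
    evertseGyory_thm_4_2_1_rat → ∃ K, 1 ≤ K ∧ PastenApproximationBound K`
  (witness `K = pastenK = 480 · (16e)^8`);
* `stub_lflInput_of_approximationBound :
    1 ≤ K → PastenApproximationBound K → ∃ K, 1 ≤ K ∧ PastenApproximationBound K`
  (the trivial packaging, for any other source of the approximation bound).

Not here: any restatement of the named fact, any attempt at the unconditional statement.
-/

-- `Summit.<Summit>.<Problem>` is the mandated summit-side namespace (CONVENTIONS §2); for the
-- single-conjunct summit `ABC` the two coincide, so the duplicate `ABC.ABC` is deliberate.
set_option linter.dupNamespace false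

namespace Summit.ABC.ABC.Theorems.FewPrimeValuationProduct

open Literature.NumberTheory.DiophantineGeometry

/-- **Packaging.** Any `K ≥ 1` with `PastenApproximationBound K` witnesses the statement of
`stub_lflInput`. `[folklore]` -/
theorem stub_lflInput_of_approximationBound {K : ℝ} (hK : 1 ≤ K)
    (hP : Dioph.PastenApproximationBound K) :
    ∃ K : ℝ, 1 ≤ K ∧
      Literature.NumberTheory.DiophantineGeometry.Dioph.PastenApproximationBound K :=
  ⟨K, hK, hP⟩

/-- **Conditional discharge of `stub_lflInput`.** From the named fact
`Dioph.evertseGyory_thm_4_2_1_rat` (Evertse–Győry, *Unit Equations in Diophantine Number Theory*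
(2015), Thm 4.2.1, case `K = ℚ`; Matveev 2000 + Yu 2007), Pasten's Theorem 2.1 (`d = 1`) holds
with the absolute constant `K = pastenK = 480 · (16e)^8 ≥ 1` (`Dioph.pasten2024_thm_2_1`,
`Dioph.one_le_pastenK`), hence `∃ K ≥ 1, PastenApproximationBound K`.
[cite: Pasten2024, Theorem 2.1] -/
theorem stub_lflInput_of_evertseGyory :
    Literature.NumberTheory.DiophantineGeometry.Dioph.evertseGyory_thm_4_2_1_rat → ∃ K : ℝ, 1 ≤ K ∧ Literature.NumberTheory.DiophantineGeometry.Dioph.PastenApproximationBound K :=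
  fun h => stub_lflInput_of_approximationBound Dioph.one_le_pastenK (Dioph.pasten2024_thm_2_1 h)

end Summit.ABC.ABC.Theorems.FewPrimeValuationProduct
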